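import Summits.AtomisticToContinuum.Crystallization.Theorems.ChessboardParticlePlanesPeriodicWindowsHcPhiTaylor

/-!
# Crux `PeriodicWindows` (stmt-AtomisticToContinuum-3240), line `dense-laminar-hull` — `hc_quadTerm2`: the termwise quadratic bound of the
# 3-fold symmetrised layer sum with PER-INCREMENT Taylor thresholds (lead c12)

Variant of `hc_quadTerm` in which each of the three order-1 remainders is taken with its own threshold `m_k ≤ min(x, x + t_k)`:
`|Σ_k (F(x + t_k) − F(x))| ≤ 3|F′(x)| R + Σ_k K₂(m_k) t_k²` (`Σ t_k = 3R`). In the crude far-layer bound this allows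
`K₂(m_k) ≤ K₂(x) + K₂(x + t_k)`, turning the remainder into lattice sums over the original AND the three shifted lattices, each bounded
uniformly by the sharp counting — instead of the lossy common threshold `H² + (‖u‖ − ‖ξ‖)₊²`. Pure algebra. [folklore]
-/

noncomputable section

namespace Summit.AtomisticToContinuum.Crystallization.Theorems.PeriodicWindowsDenseLaminarHull

open Literature.MathematicalPhysics.StatisticalMechanics Filter Metric
open scoped BigOperators

/-- **`hc_quadTerm2`** (see the module docstring). [folklore] -/
theorem hc_quadTerm2 : ∀ x R t₀ t₁ t₂ m₀ m₁ m₂ : ℝ, 0 < m₀ → m₀ ≤ x → m₀ ≤ x + t₀ → 0 < m₁ → m₁ ≤ x → m₁ ≤ x + t₁ →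
    0 < m₂ → m₂ ≤ x → m₂ ≤ x + t₂ → 0 ≤ R → t₀ + t₁ + t₂ = 3 * R →
    |(((1 / 12 : ℝ) * ((x + t₀)⁻¹) ^ 6 - (1 / 6) * ((x + t₀)⁻¹) ^ 3) - ((1 / 12) * (x⁻¹) ^ 6 - (1 / 6) * (x⁻¹) ^ 3)) +
      (((1 / 12 : ℝ) * ((x + t₁)⁻¹) ^ 6 - (1 / 6) * ((x + t₁)⁻¹) ^ 3) - ((1 / 12) * (x⁻¹) ^ 6 - (1 / 6) * (x⁻¹) ^ 3)) +
      (((1 / 12 : ℝ) * ((x + t₂)⁻¹) ^ 6 - (1 / 6) * ((x + t₂)⁻¹) ^ 3) - ((1 / 12) * (x⁻¹) ^ 6 - (1 / 6) * (x⁻¹) ^ 3))| ≤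
      3 * |-(1 / 2) * (x⁻¹) ^ 7 + (1 / 2) * (x⁻¹) ^ 4| * R +
        (((7 / 2) * (m₀⁻¹) ^ 8 + 2 * (m₀⁻¹) ^ 5) * t₀ ^ 2 + ((7 / 2) * (m₁⁻¹) ^ 8 + 2 * (m₁⁻¹) ^ 5) * t₁ ^ 2 +
          ((7 / 2) * (m₂⁻¹) ^ 8 + 2 * (m₂⁻¹) ^ 5) * t₂ ^ 2) := by
  intro x R t₀ t₁ t₂ m₀ m₁ m₂ hm₀ hx₀ h₀ hm₁ hx₁ h₁ hm₂ hx₂ h₂ _hR hsum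
  obtain ⟨-, htaylor⟩ := hc_phiTaylor
  have r₀ := (htaylor x (x + t₀) m₀ hm₀ hx₀ h₀).1
  have r₁ := (htaylor x (x + t₁) m₁ hm₁ hx₁ h₁).1
  have r₂ := (htaylor x (x + t₂) m₂ hm₂ hx₂ h₂).1
  simp only [add_sub_cancel_left] at r₀ r₁ r₂
  set D := -(1 / 2) * (x⁻¹) ^ 7 + (1 / 2) * (x⁻¹) ^ 4 with hD
  set K₀ := (7 / 2) * (m₀⁻¹) ^ 8 + 2 * (m₀⁻¹) ^ 5 with hK₀
  set K₁ := (7 / 2) * (m₁⁻¹) ^ 8 + 2 * (m₁⁻¹) ^ 5 with hK₁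
  set K₂ := (7 / 2) * (m₂⁻¹) ^ 8 + 2 * (m₂⁻¹) ^ 5 with hK₂
  set F : ℝ → ℝ := fun y => (1 / 12) * (y⁻¹) ^ 6 - (1 / 6) * (y⁻¹) ^ 3 with hF
  have e : (F (x + t₀) - F x) + (F (x + t₁) - F x) + (F (x + t₂) - F x) =
      D * (3 * R) + ((F (x + t₀) - F x - D * t₀) + (F (x + t₁) - F x - D * t₁) + (F (x + t₂) - F x - D * t₂)) := by
    rw [← hsum]; ring
  have hmain : |(F (x + t₀) - F x) + (F (x + t₁) - F x) + (F (x + t₂) - F x)| ≤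
      3 * |D| * R + (K₀ * t₀ ^ 2 + K₁ * t₁ ^ 2 + K₂ * t₂ ^ 2) := by
    rw [e]
    have hDR : |D * (3 * R)| = 3 * |D| * R := by
      rw [abs_mul, abs_of_nonneg (by positivity : (0 : ℝ) ≤ 3 * R)]; ring
    have q₀ : |F (x + t₀) - F x - D * t₀| ≤ K₀ * t₀ ^ 2 := by simpa [hF, hD, hK₀] using r₀
    have q₁ : |F (x + t₁) - F x - D * t₁| ≤ K₁ * t₁ ^ 2 := by simpa [hF, hD, hK₁] using r₁
    have q₂ : |F (x + t₂) - F x - D * t₂| ≤ K₂ * t₂ ^ 2 := by simpa [hF, hD, hK₂] using r₂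
    calc |D * (3 * R) + ((F (x + t₀) - F x - D * t₀) + (F (x + t₁) - F x - D * t₁) + (F (x + t₂) - F x - D * t₂))|
        ≤ |D * (3 * R)| + |(F (x + t₀) - F x - D * t₀) + (F (x + t₁) - F x - D * t₁) + (F (x + t₂) - F x - D * t₂)| :=
          abs_add_le _ _
      _ ≤ |D * (3 * R)| + (|F (x + t₀) - F x - D * t₀| + |F (x + t₁) - F x - D * t₁| + |F (x + t₂) - F x - D * t₂|) := by
          gcongr
          exact (abs_add_le _ _).trans (by gcongr; exact abs_add_le _ _)
      _ ≤ 3 * |D| * R + (K₀ * t₀ ^ 2 + K₁ * t₁ ^ 2 + K₂ * t₂ ^ 2) := by rw [hDR]; linarith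
  simpa [hF, hD, hK₀, hK₁, hK₂] using hmain

end Summit.AtomisticToContinuum.Crystallization.Theorems.PeriodicWindowsDenseLaminarHull

end
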